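import Mathlib
import Summits.RiemannHypothesis.Statement
import HarnessLib

/-!
# Splittings — the natural Nyman–Beurling approximants invert `ζ` uniformly on `Re s = 3`
# (SPLIT-nb-neg gen 2, part 2/3: the arithmetic input, RH-free)

`natural_lineDecay_three` — **PROVED**: for the NATURAL approximants
`V_N(s) = Σ_{n≤N} μ(n)(1 - log n/log N) n^{-s}` (integrand of the crux `Theses.NymanBeurling.NbMoebiusMollifier`),
`sup_t ‖1 - ζ(3+it)V_N(3+it)‖ ≤ C/log N + Σ_{k>N} k⁻² → 0`, from the coefficient identities
`(ζ ⋆ w_N)(k) = [k=1] + Λ(k)/log N` (`k ≤ N`; Möbius inversion + `Σ_{d|k} μ(d) log d = -Λ(k)`, Mathlib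
`coe_moebius_mul_coe_zeta`, `sum_moebius_mul_log_eq`) and `|(ζ ⋆ w_N)(k)| ≤ d(k) ≤ k` (`k > N`), via Mathlib's
`LSeries_convolution'`.  The coefficient function `w` of `V_N` (`w(n) = μ(n)(1 - log n/log N)` for `n ≤ N`, `0`
beyond) enters through its defining hypothesis `hw` (section `NaturalApproximant`); no definition is introduced.
Used by part 3/3 (`NbBddNatural.lean`) to turn the abstract three-lines label lemma into the card's target T2
`liminf_N I(V_N) < ∞ ⟹ RH`.  [folklore: elementary Dirichlet-series bookkeeping]

Provenance: cell rh-split, seat rh-split-nb-neg g2, zero-definition raw form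
`HOME/rh-split-nb-neg/NbBddNaturalRaw.lean` (sha16 4786d65a4b4f27e0, 720 lines; proofs verbatim), split in
three files (≤ 400 lines each: `NbBddNaturalThreeLines` test-function estimates / `NbBddNaturalLineDecay`
arithmetic input / `NbBddNatural` label lemma + target T2) and filed by rh-split-typer-1 g2 on the lead's GO
2026-08-26T19:39Z (HANDOFF-list item 1).  Referee (rh-split-ref g0) addendum 19:34Z on cards/SPLIT-nb-neg.md:
label lemma replayed std; «(A) three-lines criterion and (B) natural line decay checked on paper;
bddNaturalCriterion = liminf I(V_N) < ∞ ⟹ RH, converse open ⇒ decoration as a conjunct, by theorem»; class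
UNCHANGED (barrier-note).  Typer-1 g2 replay 20:02Z of the 720-line raw form: farm rc 0, 0 warnings, 0 sorry,
`#print axioms rh_of_frequently_bdd_natural` = [propext, Classical.choice, Quot.sound].

HONEST LABEL: «SPLITTING SEARCH over kernel-typed RH-EQUIVALENCES; a splitting A ∧ B ⟹ RH is
CONDITIONAL bookkeeping unless A and B are both proved; nothing here bears on the truth of RH.»
-/

set_option linter.dupNamespace false

noncomputable section

open Complex MeasureTheory Set Filter Topology
open scoped Real ENNReal
open scoped LSeries.notation

namespace Summit.RiemannHypothesis.RiemannHypothesis.Theorems.Splittings.NbBddNatural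

/-! # Arithmetic: the natural approximants invert `ζ` uniformly on `Re s = 3` -/

/-- `δ` has a summable L-series on `Re s > 1`. -/
theorem LSeriesSummable_delta_of_one_lt_re {s : ℂ} (hs : 1 < s.re) : LSeriesSummable δ s :=
  LSeriesSummable_of_bounded_of_one_lt_re (m := 1) (fun n _ ↦ by
    simp only [LSeries.delta]; split_ifs <;> simp) hs

/-- `(↗ζ ⍟ g)(k) = Σ_{d ∣ k} g(d)`. -/
theorem zeta_convolution_apply (g : ℕ → ℂ) (k : ℕ) :
    ((fun n ↦ (ArithmeticFunction.zeta n : ℂ)) ⍟ g) k = ∑ d ∈ k.divisors, g d := by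
  rw [LSeries.convolution_def]
  dsimp only
  rw [Nat.sum_divisorsAntidiagonal' (fun x y ↦ (ArithmeticFunction.zeta x : ℂ) * g y)]
  refine Finset.sum_congr rfl fun d hd ↦ ?_
  have hd0 : k / d ≠ 0 :=
    (Nat.div_pos (Nat.divisor_le hd) (Nat.pos_of_mem_divisors hd)).ne'
  rw [ArithmeticFunction.zeta_apply_ne hd0, Nat.cast_one, one_mul]

/-- `C/log N + Σ_{k>N} k⁻² → 0`. -/
theorem tendsto_lineBound :
    Tendsto (fun N : ℕ ↦ (Real.log N)⁻¹ * (∑' k : ℕ, 1 / (k : ℝ) ^ 2) +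
      ∑' k : ℕ, 1 / ((k + (N + 1) : ℕ) : ℝ) ^ 2) atTop (𝓝 0) := by
  set C : ℝ := ∑' k : ℕ, 1 / (k : ℝ) ^ 2 with hC
  have h1 : Tendsto (fun N : ℕ ↦ Real.log (N : ℝ)) atTop atTop :=
    Real.tendsto_log_atTop.comp tendsto_natCast_atTop_atTop
  have h2 : Tendsto (fun N : ℕ ↦ (Real.log (N : ℝ))⁻¹ * C) atTop (𝓝 0) := by
    have := h1.inv_tendsto_atTop.mul_const C
    rw [zero_mul] at this
    exact this
  have h3 : Tendsto (fun N : ℕ ↦ ∑' k : ℕ, 1 / ((k + (N + 1) : ℕ) : ℝ) ^ 2) atTop (𝓝 0) :=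
    (tendsto_sum_nat_add (fun k : ℕ ↦ 1 / (k : ℝ) ^ 2)).comp (tendsto_add_atTop_nat 1)
  simpa using h2.add h3

section NaturalApproximant

/-! In this section `w` is the coefficient function of the natural approximant `V_N`, truncated at `N`:
`w(n) = μ(n)(1 - log n / log N)` for `n ≤ N`, `0` beyond (hypothesis `hw`; no definition is introduced). -/

variable {N : ℕ} {w : ℕ → ℂ}
  (hw : ∀ n : ℕ, w n = if n ≤ N then
    (((ArithmeticFunction.moebius n : ℝ) * (1 - Real.log n / Real.log N) : ℝ) : ℂ) else 0)
include hw

/-- `|w(n)| ≤ 1`. -/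
theorem norm_wN_le_one (n : ℕ) : ‖w n‖ ≤ 1 := by
  rw [hw]
  split_ifs with h
  · rw [Complex.norm_real, Real.norm_eq_abs, abs_mul]
    have h1 : |(ArithmeticFunction.moebius n : ℝ)| ≤ 1 := by
      have : |ArithmeticFunction.moebius n| ≤ 1 := by
        rw [ArithmeticFunction.abs_moebius]; split_ifs <;> norm_num
      rw [← Int.cast_abs]; exact_mod_cast this
    have hlogn : 0 ≤ Real.log n := Real.log_natCast_nonneg n
    have hlogN : 0 ≤ Real.log N := Real.log_natCast_nonneg N
    have hle : Real.log n ≤ Real.log N := by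
      rcases Nat.eq_zero_or_pos n with rfl | hn
      · simpa using hlogN
      · exact Real.log_le_log (by exact_mod_cast hn) (by exact_mod_cast h)
    have h2 : |1 - Real.log n / Real.log N| ≤ 1 := by
      rcases hlogN.eq_or_lt with h0 | hpos
      · rw [← h0, div_zero, sub_zero, abs_one]
      · rw [abs_le]
        constructor
        · have : Real.log n / Real.log N ≤ 1 := (div_le_one hpos).mpr hle
          linarith
        · have : 0 ≤ Real.log n / Real.log N := div_nonneg hlogn hpos.le
          linarith
    calc |(ArithmeticFunction.moebius n : ℝ)| * |1 - Real.log n / Real.log N| ≤ 1 * 1 := by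
          gcongr
      _ = 1 := one_mul 1
  · simp

/-- `V_N(s)` (the `Fin N`-indexed sum of the route file) is the L-series of `w_N`. -/
theorem VN_eq_LSeries (s : ℂ) :
    ∑ n : Fin N, ((ArithmeticFunction.moebius (n + 1) : ℝ) *
        (1 - Real.log ((n : ℝ) + 1) / Real.log N) : ℂ) * ((n : ℂ) + 1) ^ (-s) =
      LSeries w s := by
  have hsupp : ∀ k ∉ Finset.range (N + 1), LSeries.term w s k = 0 := by
    intro k hk
    rw [Finset.mem_range, not_lt] at hk
    rw [LSeries.term_of_ne_zero (by omega), hw, if_neg (by omega), zero_div]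
  rw [LSeries, tsum_eq_sum hsupp, Finset.sum_range_succ', LSeries.term_zero, add_zero,
    ← Fin.sum_univ_eq_sum_range]
  refine Finset.sum_congr rfl fun n _ ↦ ?_
  have hn : (n : ℕ) + 1 ≤ N := n.isLt
  rw [LSeries.term_of_ne_zero (Nat.succ_ne_zero _), hw, if_pos hn, cpow_neg, div_eq_mul_inv]
  push_cast
  ring

/-- The L-series of `w` converges absolutely on `Re s > 1`. -/
theorem LSeriesSummable_wN {s : ℂ} (hs : 1 < s.re) : LSeriesSummable w s :=
  LSeriesSummable_of_bounded_of_one_lt_re (fun n _ ↦ norm_wN_le_one hw n) hs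

/-- The coefficients of `ζ(s) V_N(s)` for `k ≤ N`: `(ζ ⋆ w)(k) = [k=1] + Λ(k)/log N`. -/
theorem cN_apply_of_le {k : ℕ} (hkN : k ≤ N) :
    ((fun n ↦ (ArithmeticFunction.zeta n : ℂ)) ⍟ w) k =
      δ k + ((ArithmeticFunction.vonMangoldt k / Real.log N : ℝ) : ℂ) := by
  rw [zeta_convolution_apply]
  have h1 : ∑ d ∈ k.divisors, w d = ∑ d ∈ k.divisors,
      (((ArithmeticFunction.moebius d : ℝ) * (1 - Real.log d / Real.log N) : ℝ) : ℂ) := by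
    refine Finset.sum_congr rfl fun d hd ↦ ?_
    have : d ≤ N := (Nat.divisor_le hd).trans hkN
    rw [hw, if_pos this]
  rw [h1, ← Complex.ofReal_sum]
  have h2 : ∑ d ∈ k.divisors, (ArithmeticFunction.moebius d : ℝ) * (1 - Real.log d / Real.log N) =
      (∑ d ∈ k.divisors, (ArithmeticFunction.moebius d : ℝ)) -
        (∑ d ∈ k.divisors, (ArithmeticFunction.moebius d : ℝ) * Real.log d) / Real.log N := by
    rw [Finset.sum_div, ← Finset.sum_sub_distrib]
    refine Finset.sum_congr rfl fun d _ ↦ ?_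
    ring
  have h3 : ∑ d ∈ k.divisors, (ArithmeticFunction.moebius d : ℝ) * Real.log d =
      -ArithmeticFunction.vonMangoldt k := by
    rw [← ArithmeticFunction.sum_moebius_mul_log_eq]
    exact Finset.sum_congr rfl fun d _ ↦ by rw [ArithmeticFunction.log_apply]
  -- `Σ_{d ∣ k} μ(d) = [k = 1]` over `ℝ` (folklore; landed e.g. as
  -- `Literature.NumberTheory.Sieve.Iwaniec1978.sum_divisors_moebius_eq_ite` — inlined to keep the NB import cone small)
  have hμ : ∑ d ∈ k.divisors, (ArithmeticFunction.moebius d : ℝ) = if k = 1 then 1 else 0 := by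
    have h := congrArg (fun f : ArithmeticFunction ℝ ↦ f k)
      (ArithmeticFunction.coe_moebius_mul_coe_zeta (R := ℝ))
    simp only [ArithmeticFunction.coe_mul_zeta_apply, ArithmeticFunction.intCoe_apply,
      ArithmeticFunction.one_apply] at h
    exact h
  rw [h2, hμ, h3]
  simp only [LSeries.delta]
  split_ifs with hk1
  · push_cast; ring
  · push_cast; ring

/-- For all `k`: `|(ζ ⋆ w)(k)| ≤ d(k) ≤ k`. -/
theorem norm_cN_le (k : ℕ) : ‖((fun n ↦ (ArithmeticFunction.zeta n : ℂ)) ⍟ w) k‖ ≤ k := by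
  rw [zeta_convolution_apply]
  calc ‖∑ d ∈ k.divisors, w d‖ ≤ ∑ d ∈ k.divisors, ‖w d‖ := norm_sum_le _ _
    _ ≤ ∑ d ∈ k.divisors, (1 : ℝ) := Finset.sum_le_sum fun d _ ↦ norm_wN_le_one hw d
    _ = k.divisors.card := by simp
    _ ≤ k := by exact_mod_cast Nat.card_divisors_le_self k

/-- The estimate on the line `Re s = 3`: `‖ζ(s)V_N(s) - 1‖ ≤ C/log N + Σ_{k>N} k⁻²` (`N ≥ 2`). -/
theorem norm_zeta_mul_VN_sub_one_le (hN : 2 ≤ N) (t : ℝ) :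
    ‖riemannZeta ((3 : ℝ) + t * I) * LSeries w ((3 : ℝ) + t * I) - 1‖ ≤
      (Real.log N)⁻¹ * (∑' k : ℕ, 1 / (k : ℝ) ^ 2) + ∑' k : ℕ, 1 / ((k + (N + 1) : ℕ) : ℝ) ^ 2 := by
  set s : ℂ := (3 : ℝ) + t * I with hs_def
  have hsre : s.re = 3 := by simp [hs_def]
  have hs1 : 1 < s.re := by rw [hsre]; norm_num
  have hlogN : 0 < Real.log N := Real.log_pos (by exact_mod_cast (by omega : 1 < N))
  have hζs : LSeriesSummable (fun n ↦ (ArithmeticFunction.zeta n : ℂ)) s :=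
    ArithmeticFunction.LSeriesSummable_zeta_iff.mpr hs1
  have hws := LSeriesSummable_wN hw hs1
  have hcs : LSeriesSummable ((fun n ↦ (ArithmeticFunction.zeta n : ℂ)) ⍟ w) s :=
    hζs.convolution hws
  have hδs := LSeriesSummable_delta_of_one_lt_re hs1
  have hprod : riemannZeta s * LSeries w s =
      LSeries ((fun n ↦ (ArithmeticFunction.zeta n : ℂ)) ⍟ w) s := by
    rw [← ArithmeticFunction.LSeries_zeta_eq_riemannZeta hs1, LSeries_convolution' hζs hws]
  have hone : (1 : ℂ) = LSeries δ s := by rw [LSeries_delta]; rfl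
  rw [hprod, hone, ← LSeries_sub hcs hδs, LSeries]
  set g : ℕ → ℝ := fun k ↦
    ‖LSeries.term (((fun n ↦ (ArithmeticFunction.zeta n : ℂ)) ⍟ w) - δ) s k‖ with hg_def
  have hgs : Summable g := (hcs.sub hδs).norm
  have h3 : (3 : ℝ) = ((3 : ℕ) : ℝ) := by norm_num
  have hfin : ∀ k ∈ Finset.range (N + 1), g k ≤ (Real.log N)⁻¹ * (1 / (k : ℝ) ^ 2) := by
    intro k hk
    have hkN : k ≤ N := by rw [Finset.mem_range] at hk; omega
    rcases Nat.eq_zero_or_pos k with rfl | hk0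
    · simp [hg_def]
    · have hk0' : k ≠ 0 := hk0.ne'
      have hkpos : (0 : ℝ) < k := by exact_mod_cast hk0
      simp only [hg_def]
      rw [LSeries.norm_term_eq, if_neg hk0', Pi.sub_apply, cN_apply_of_le hw hkN, add_sub_cancel_left,
        Complex.norm_real, Real.norm_eq_abs,
        abs_of_nonneg (div_nonneg ArithmeticFunction.vonMangoldt_nonneg hlogN.le), hsre, h3,
        Real.rpow_natCast]
      have hΛ : ArithmeticFunction.vonMangoldt k ≤ k := by
        have h1' := ArithmeticFunction.vonMangoldt_le_log (n := k)
        have h2' := Real.log_le_sub_one_of_pos hkpos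
        linarith
      rw [div_div, div_le_iff₀ (by positivity)]
      calc ArithmeticFunction.vonMangoldt k ≤ k := hΛ
        _ = (Real.log N)⁻¹ * (1 / (k : ℝ) ^ 2) * (Real.log N * (k : ℝ) ^ 3) := by
            field_simp
  have htail : ∀ j : ℕ, g (j + (N + 1)) ≤ 1 / ((j + (N + 1) : ℕ) : ℝ) ^ 2 := by
    intro j
    have hk1 : j + (N + 1) ≠ 1 := by omega
    have hk0 : j + (N + 1) ≠ 0 := by omega
    have hkpos : (0 : ℝ) < ((j + (N + 1) : ℕ) : ℝ) := by positivity
    have hδ0 : δ (j + (N + 1)) = 0 := by simp [LSeries.delta, hk1]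
    simp only [hg_def]
    rw [LSeries.norm_term_eq, if_neg hk0, Pi.sub_apply, hδ0, sub_zero, hsre, h3, Real.rpow_natCast]
    calc ‖((fun n ↦ (ArithmeticFunction.zeta n : ℂ)) ⍟ w) (j + (N + 1))‖ /
          ((j + (N + 1) : ℕ) : ℝ) ^ 3
        ≤ ((j + (N + 1) : ℕ) : ℝ) / ((j + (N + 1) : ℕ) : ℝ) ^ 3 := by
          gcongr; exact norm_cN_le hw _
      _ = 1 / ((j + (N + 1) : ℕ) : ℝ) ^ 2 := by
          field_simp
  have hgs' : Summable fun j ↦ g (j + (N + 1)) := (summable_nat_add_iff (N + 1)).mpr hgs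
  have hsq : Summable fun k : ℕ ↦ 1 / (k : ℝ) ^ 2 := Real.summable_one_div_nat_pow.mpr one_lt_two
  have hinv' : Summable fun j : ℕ ↦ 1 / ((j + (N + 1) : ℕ) : ℝ) ^ 2 :=
    (summable_nat_add_iff (f := fun k : ℕ ↦ 1 / (k : ℝ) ^ 2) (N + 1)).mpr hsq
  calc ‖∑' k, LSeries.term (((fun n ↦ (ArithmeticFunction.zeta n : ℂ)) ⍟ w) - δ) s k‖
        ≤ ∑' k, g k := norm_tsum_le_tsum_norm hgs
    _ = ∑ k ∈ Finset.range (N + 1), g k + ∑' j, g (j + (N + 1)) :=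
        (hgs.sum_add_tsum_nat_add (N + 1)).symm
    _ ≤ ∑ k ∈ Finset.range (N + 1), (Real.log N)⁻¹ * (1 / (k : ℝ) ^ 2) +
          ∑' j : ℕ, 1 / ((j + (N + 1) : ℕ) : ℝ) ^ 2 :=
        add_le_add (Finset.sum_le_sum hfin) (hgs'.tsum_le_tsum htail hinv')
    _ ≤ (Real.log N)⁻¹ * (∑' k : ℕ, 1 / (k : ℝ) ^ 2) + ∑' k : ℕ, 1 / ((k + (N + 1) : ℕ) : ℝ) ^ 2 := by
        rw [← Finset.mul_sum]
        refine add_le_add ?_ le_rfl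
        exact mul_le_mul_of_nonneg_left
          (hsq.sum_le_tsum _ (fun k _ ↦ by positivity)) (inv_nonneg.mpr hlogN.le)

end NaturalApproximant

/-- ARITHMETIC INPUT (theorem): on the line `Re s = 3` the natural approximants
`V_N(s) = Σ_{n≤N} μ(n)(1 - log n/log N) n^{-s}` invert `ζ` uniformly: `sup_t ‖1 - ζ(3+it) V_N(3+it)‖ → 0`. -/
theorem natural_lineDecay_three : ∀ ε : ℝ, 0 < ε → ∀ᶠ N : ℕ in atTop, ∀ t : ℝ,
    ‖1 - riemannZeta ((3 : ℝ) + t * I) * ∑ n : Fin N,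
      ((ArithmeticFunction.moebius (n + 1) : ℝ) * (1 - Real.log ((n : ℝ) + 1) / Real.log N) : ℂ) *
        ((n : ℂ) + 1) ^ (-((3 : ℝ) + t * I))‖ ≤ ε := by
  intro ε hε
  filter_upwards [tendsto_lineBound.eventually (gt_mem_nhds hε), eventually_ge_atTop 2]
    with N hN hN2 t
  have hw : ∀ n : ℕ, (fun n : ℕ ↦ if n ≤ N then
      (((ArithmeticFunction.moebius n : ℝ) * (1 - Real.log n / Real.log N) : ℝ) : ℂ) else 0) n =
      if n ≤ N then (((ArithmeticFunction.moebius n : ℝ) * (1 - Real.log n / Real.log N) : ℝ) : ℂ)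
      else 0 := fun n ↦ rfl
  rw [norm_sub_rev, VN_eq_LSeries hw]
  exact (norm_zeta_mul_VN_sub_one_le hw hN2 t).trans hN.le

end Summit.RiemannHypothesis.RiemannHypothesis.Theorems.Splittings.NbBddNatural

end
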